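/-
Copyright: cell pub-balaban-gaps (YM BLITZ Y1, track G1), seat g1-p2 GEN 2 (unit `pub-balaban-gaps-g1-p2-g2`).  Rows (D4) ∧ NE5:
the CONSUMER-side junction «NE5's torus family of H-layer data + seams + the (1.22) pin ⟹ (D4) at one (k, p)», BY NAME over
ne5's `Spine.NE5.StepObjectFromActivities.polLeavesTFac190HOfActivities` and this seat's `Gaps.D4ScaleSlice.abs_beta1_le_of_leaves_at`.
HONEST FRAMING: bookkeeping; no object of Bałaban's; (D4) NOT discharged (instance 0∕1), NE5 NOT proved; NOT BetaPertH, NOT continuum,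
NOT Clay.
-/
import Summits.QuantumFields.BalabanUV.T4Continuum.Spine.NE5.StepObjectFromActivities
import Summits.QuantumFields.BalabanUV.Gaps.D4ScaleSlice

/-!
# `Gaps.D4FromNE5Activities` — (D4) at one (k, p) from a torus family of NE5-type H-layer data (cell pub-balaban-gaps, seat g1-p2)

HONEST DEPENDENCY (cell pub-balaban, verbatim): continuum YM on T⁴ ⇐ BetaPertH ∧ nine spine estimates (0/9 proved);
BetaPertH ⇐ (D1) ∧ (D4) ∧ CAP+tail.

The gaps cell's NE5 seat typed the H-LAYER JUNCTION NE5 ⟹ D4 (`Spine.NE5.StepObjectFromActivities`, lead R14, row-D4 owner an4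
W-an4-g86-2 GO): a torus family of activity data `act n : Op × Hist → 𝐃 → ℂ` analytic on a data region `V n` with the Lemma-3
majorant, configuration types with data maps, seams into the α₂-ball, plus exactly the row-D4 adapter's remaining data ((190),
(1.7)-factorization, test-vector convergence, read-out `a`) ⟹ the (D4) leaf list `PolLeavesTFac190H d M a c ℓ α₂ q`
(`polLeavesTFac190HOfActivities`).  This file closes the triangle on the CONSUMER side, by name: the same data at `d = 4` + the
(1.22) identification of `β¹_{k+1}(p)` with the second moment of the limit kernel `a` + N1–N2 ⟹ `|β¹_{k+1}(p)| ≤ ε₁·K_rem,L`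
(`Gaps.D4ScaleSlice.abs_beta1_le_of_leaves_at`).  Nothing is constructed; every input is a hypothesis; for Bałaban's objects the
count is 0∕1 on both rows.  [cite tags are CONTEXT ONLY.]
-/

namespace Summit.QuantumFields.BalabanUV.Gaps.D4FromNE5Activities

open Filter Metric Set
open scoped Topology
open Literature.MathematicalPhysics.QuantumFieldTheory.Balaban1983to89
open FlowStep
open Literature.MathematicalPhysics.QuantumFieldTheory.Balaban1983to89.TreeLengthTorus (TDom proj torusTreeLen)
open Literature.MathematicalPhysics.QuantumFieldTheory.Balaban1983to89.B13ScaleTransfer (Pt)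
open Literature.MathematicalPhysics.QuantumFieldTheory.Balaban1983to89.Beta.RemainderChainLattice (CondsL SignsL remCoeffL)
open Literature.MathematicalPhysics.QuantumFieldTheory.Balaban1983to89.Beta.RemainderLimitTorus (LDom limKernel tproj)
open Literature.MathematicalPhysics.QuantumFieldTheory.Balaban1983to89.Beta.RemainderDecay190 (Consts190 Data190)
open Literature.MathematicalPhysics.QuantumFieldTheory.Balaban1983to89.B12Decay510 (mixedDeriv)
open Summit.QuantumFields.BalabanUV.T4Continuum.Spine.NE5 (stepObjectOfActivities polLeavesTFac190HOfActivities)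

variable {M : ℕ} [NeZero M] {μ ν : Fin 4} {β : HBeta} {Sβ : B12Beta.OneLoopSplit β} {c : B13.Consts} {ℓ α₂ : ℝ}
  {q : Consts190}
variable {Op Hist : Type*} [NormedAddCommGroup Op] [NormedSpace ℂ Op] [NormedAddCommGroup Hist] [NormedSpace ℂ Hist]

/-- **(D4) AT ONE (k, p) FROM A TORUS FAMILY OF NE5-TYPE H-LAYER DATA** (d = 4): the hypotheses of
`Spine.NE5.StepObjectFromActivities.polLeavesTFac190HOfActivities` verbatim (exhausting tori `N n → ∞`; activities `act n`
ℂ-differentiable on `V n` with the Lemma-3 majorant `C₃ε₁e^{−(1−8δ)ℓκ·d(Z)}`; data maps, seams into the α₂-ball staying in `V n`;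
`CondsL`; the (190) data, the (1.7)-factorization through torus-independent spaces, test-vector convergence and the read-out `a`)
+ the (1.22) identification `Sβ.β1 k p = Σ_x a(x)x_μx_ν` + the closing relation and N2 ⟹ `|Sβ.β1 k p| ≤ ε₁·K_rem,L(4, M, c, α₂, B₃(q))`
— `Gaps.D4ScaleSlice.abs_beta1_le_of_leaves_at ∘ polLeavesTFac190HOfActivities`.  Every input a hypothesis; instance 0∕1.
[cite: Balaban1987RG1, (1.22) p.264, (4.4) p.281; Balaban1988RG2Cluster, Lemma 3 (2.38) p.20] -/
theorem abs_beta1_le_of_activities_at {k : ℕ} {p : Fin (k + 1) → ℝ}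
    (N : ℕ → ℕ) [hN : ∀ n, NeZero (N n)] (hNlim : Tendsto N atTop atTop)
    (Φ : ℕ → Type) (dat : (n : ℕ) → Φ n → Op × Hist) (act : (n : ℕ) → Op × Hist → TDom 4 (N n) → ℂ)
    (V : ℕ → Set (Op × Hist))
    (hmaj : ∀ n, ∀ z ∈ V n, ∀ Z : TDom 4 (N n),
      ‖act n z Z‖ ≤ c.C3act * c.ε₁ * Real.exp (-((1 - 8 * c.δ) * ℓ * c.κ * torusTreeLen Z.1)))
    (hhol : ∀ n, ∀ Z : TDom 4 (N n), DifferentiableOn ℂ (fun z : Op × Hist => act n z Z) (V n))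
    (Wn : ℕ → Type) [instW : ∀ n, NormedAddCommGroup (Wn n)] [instWs : ∀ n, NormedSpace ℂ (Wn n)]
    (s : (n : ℕ) → TDom 4 (N n) → Wn n → Φ n)
    (hs : ∀ n X, DifferentiableOn ℂ (fun v => dat n (s n X v)) (ball 0 α₂))
    (hmaps : ∀ n X, MapsTo (fun v => dat n (s n X v)) (ball 0 α₂) (V n))
    (D : Data190 4 M N Wn q)
    (Vsp : LDom 4 → Type) [instV : ∀ Y, NormedAddCommGroup (Vsp Y)] [instVs : ∀ Y, NormedSpace ℂ (Vsp Y)]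
    (F : (Y : LDom 4) → Vsp Y → ℂ) (hFd : ∀ Y, ∃ ρ > 0, DifferentiableOn ℂ (F Y) (ball 0 ρ))
    (r : (n : ℕ) → (Y : LDom 4) → Wn n →L[ℂ] Vsp Y)
    (hfac : ∀ Y : LDom 4, ∀ᶠ n in atTop, ∀ v ∈ ball (0 : Wn n) α₂,
      (stepObjectOfActivities (Φ n) (dat n) (act n) (V n)).E (tproj (N n) Y) (s n (tproj (N n) Y) v) = F Y (r n Y v))
    (t : (Y : LDom 4) → Pt 4 → Vsp Y)
    (hconv : ∀ (Y : LDom 4) (x : Pt 4),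
      Tendsto (fun n => r n Y (D.hn n (tproj (N n) Y) (proj (N n * M) x))) atTop (𝓝 (t Y x)))
    (a : LDom 4 → Pt 4 → ℝ) (ha : ∀ (Y : LDom 4) (z : Pt 4), a Y z = (mixedDeriv (F Y) (t Y 0) (t Y z)).re)
    (hβ1 : Sβ.β1 k p = B12Beta.secondMoment (fun _ _ => limKernel a) μ ν)
    (hC : CondsL 4 c ℓ) (h22 : c.R22gen ℓ) (hq : q.Valid c.δ₀) (hsg : SignsL c α₂ q.B₃) :
    |Sβ.β1 k p| ≤ c.ε₁ * remCoeffL 4 M c α₂ q.B₃ :=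
  D4ScaleSlice.abs_beta1_le_of_leaves_at a
    (polLeavesTFac190HOfActivities N hNlim Φ dat act V c ℓ α₂ q hmaj hC hsg.A hhol Wn s hs hmaps D Vsp F hFd r hfac t
      hconv a ha)
    hβ1 hC h22 hq hsg

end Summit.QuantumFields.BalabanUV.Gaps.D4FromNE5Activities
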